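import Summits.QuantumFields.BalabanUV.T4Continuum.Support.RegionElectricSplitting

/-!
# T⁴ programme, spine node NE2 (U1a), sub-row Δ1 «NE2⁰-Dirichlet» — THE ELECTRIC OPERATOR ON AN ARBITRARY UNION OF BLOCKS:
# `curlRᴴcurlR + gradR·gradRᴴ = Σ_μ W_μ + C`, with the CORNER COUPLING `C = n²·diag(own charge) − E·Eᴴ` (`E` = the exterior-gradient block),
# `re⟨A, C A⟩ = n²·Σ_b cnt1 (b.2) b‖A b‖² − extFlux A`, and `C = 0` under `AtMostOneNeighbour`

NE2 formalisation swarm `b2b-balaban-t4-ne2-formalise-*`, LEAF PROVER 02 (gen 8), item «Δ1-LOC-HESS» file 6 (own initiative after the item closed;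
groundwork for the owner's located NEXT FRONT, ruling R37 (e), journal 2026-08-20 l.≈22730: «on regions with RE-ENTRANT CONTACT … `Δ_loc` is NO
LONGER COMPONENTWISE — the exterior-flux block `E·Eᴴ` (leaf-02-g8 F1, any region) couples the two normal star bonds of different components at
every re-entrant exterior site»).  File 1 (`RegionElectricSplitting`, p238744) proved the splitting `curlRᴴcurlR + gradR·gradRᴴ = Σ_μ W_μ` under H1
only; THIS FILE types the general case, for EVERY decidable `S`:

 * §1 **`extGrad`** `= (∂)_{V,Ωᶜ}` — the block of the torus gradient from the EXTERIOR scalars to the star bonds —, `extGrad_conjTranspose_mulVec`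
   (`Eᴴ A = (∂ᴴ ιA)|_{Ωᶜ}`, the exterior divergence), **`nsq_extGrad_conjTranspose_mulVec`** (`‖EᴴA‖² = extFlux A`), `form_extGram`
   (`⟨A, E·Eᴴ A⟩ = extFlux A`).
 * §2 **`cornerC := diag(n²·cnt1 (b.2) b) − E·Eᴴ`** (Hermitian), its form **`form_cornerC`** (`re⟨A, C A⟩ = n²·Σ_b cnt1 (b.2) b‖A b‖² − extFlux A`:
   the own-direction zero-extension charges MINUS the exterior flux), and THE GENERAL SPLITTING **`electric_general :
   curlRᴴ·curlR + gradR·gradRᴴ = Σ_μ Wdir μ + cornerC`** (ANY region; polarization of gen 6's `gaffney_region` + gen 7's `sum_nsq_fdiff_ext_eq`).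
 * §3 under H1 the coupling VANISHES: **`cornerC_eq_zero (hH : AtMostOneNeighbour n M S) : cornerC n M S = 0`** (file 1's `extFlux_eq`), recovering
   `electric_splitting`; on a general union `C` is supported on the star bonds attached to exterior sites with two or more attached bonds (the
   codimension-2 re-entrant contact set) — the located obstruction to a componentwise treatment of `Δ_loc` there (prose; its norm `≍ n²` on that
   set is the successor's estimate).

HONEST FRAMING (T4-DAG p. 1).  Lattice calculus at MODEL level (`U = 1`, ONE region, finite torus); statements OURS ([folklore]); identities only — no
estimate on re-entrant regions is claimed; W3 on boxes / general unions OPEN; Δ1 NOT closed; NE2 (U1a) NOT proved; spine PROVED 0/9 unchanged; NOT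
[B9] (3.16)/(3.23)–(3.27) as printed; NOT infinite volume, NOT a mass gap, NOT the Clay problem.  HONEST DEPENDENCY: continuum YM on T⁴ ⇐ BetaPertH ∧
nine spine estimates (0/9 proved); BetaPertH ⇐ (D1) ∧ (D4) ∧ CAP+tail; G-an2-4 gates asym, D1 and NE2/3/4.  No `sorry`.
-/

noncomputable section

open scoped BigOperators ComplexConjugate Matrix Matrix.Norms.L2Operator
open Finset

namespace Summit.QuantumFields.BalabanUV.T4Continuum.RegionElectricGeneral

open Literature.MathematicalPhysics.QuantumFieldTheory.Balaban1983to89.B5Prop11Plancherel (Tor fine fdiff unitVec)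
open Literature.MathematicalPhysics.QuantumFieldTheory.Balaban1983to89.B5Prop11Lower (nsq nsq_nonneg)
open Literature.MathematicalPhysics.QuantumFieldTheory.Balaban1983to89.B5Action121 (GradOp ext_of_form_eq)
open Summit.QuantumFields.BalabanUV.T4Continuum
open Summit.QuantumFields.BalabanUV.T4Continuum.SubtypeCompression (ext_apply_of ext_apply_of_not)
open Summit.QuantumFields.BalabanUV.T4Continuum.RegionGaugeSlice (form_gram)
open Summit.QuantumFields.BalabanUV.T4Continuum.RegionGaugeFixedVector (starReg curlR gradR)
open Summit.QuantumFields.BalabanUV.T4Continuum.DirichletStarRenormTower (igrad)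
open Summit.QuantumFields.BalabanUV.T4Continuum.RegionGaffneyIdentity (extFlux gaffney_region)
open Summit.QuantumFields.BalabanUV.T4Continuum.RegionStarBoundaryCharges (AtMostOneNeighbour cntR sum_nsq_fdiff_ext_eq)
open Summit.QuantumFields.BalabanUV.T4Continuum.RegionElectricSplitting (cnt1 cnt1_nonneg tcnt Wdir form_Wdir sum_tcnt_eq form_curl_add_div
  form_diagonal_ofReal extFlux_eq)
open Summit.QuantumFields.BalabanUV.Beta.GAN24.DirichletBoxTrace (blockReg)

variable {d : ℕ}

section Region

variable (n : ℕ) [NeZero n] (M : Fin d → ℕ) [hM : ∀ μ, NeZero (M μ)] (S : Tor M → Prop) [DecidablePred S]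

/-! ## §1 The exterior-gradient block and the exterior flux -/

/-- **THE EXTERIOR-GRADIENT BLOCK** `E = (∂)_{V,Ωᶜ}`: the torus gradient from the scalars OUTSIDE `Ω` to the star bonds. [folklore] -/
def extGrad : Matrix {b // starReg n M S b} {x // ¬ blockReg n M S x} ℂ :=
  (GradOp (fine n M) (n : ℂ)).toBlock (starReg n M S) (fun x => ¬ blockReg n M S x)

/-- `Eᴴ A` is the exterior divergence of the zero extension: `(Eᴴ A)(x) = (∂ᴴ ιA)(x)` for `x ∉ Ω`. [folklore] -/
theorem extGrad_conjTranspose_mulVec (A : {b // starReg n M S b} → ℂ) (x : {x // ¬ blockReg n M S x}) :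
    ((extGrad n M S)ᴴ *ᵥ A) x = ((GradOp (fine n M) (n : ℂ))ᴴ *ᵥ SubtypeCompression.ext (starReg n M S) A) x.1 := by
  simp only [Matrix.mulVec, dotProduct, Matrix.conjTranspose_apply, extGrad, Matrix.toBlock_apply]
  rw [← Fintype.sum_subtype_add_sum_subtype (starReg n M S)
    (fun c : Tor (fine n M) × Fin d => star (GradOp (fine n M) (n : ℂ) c x.1) * SubtypeCompression.ext (starReg n M S) A c)]
  have h0 : ∑ c : {c // ¬ starReg n M S c}, star (GradOp (fine n M) (n : ℂ) c.1 x.1) * SubtypeCompression.ext (starReg n M S) A c.1 = 0 :=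
    sum_eq_zero fun c _ => by rw [ext_apply_of_not _ _ c.2, mul_zero]
  rw [h0, add_zero]
  exact sum_congr rfl fun b _ => by rw [ext_apply_of]

/-- **`‖Eᴴ A‖² = extFlux A`**. [folklore] -/
theorem nsq_extGrad_conjTranspose_mulVec (A : {b // starReg n M S b} → ℂ) : nsq ((extGrad n M S)ᴴ *ᵥ A) = extFlux n M S A := by
  unfold nsq extFlux
  exact sum_congr rfl fun x _ => by rw [extGrad_conjTranspose_mulVec]

/-- the form of the exterior Gram block: `⟨A, E·Eᴴ A⟩ = extFlux A`. [folklore] -/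
theorem form_extGram (A : {b // starReg n M S b} → ℂ) :
    star A ⬝ᵥ ((extGrad n M S * (extGrad n M S)ᴴ) *ᵥ A) = ((extFlux n M S A : ℝ) : ℂ) := by
  conv_lhs => rw [← Matrix.conjTranspose_conjTranspose (extGrad n M S)]
  rw [Matrix.conjTranspose_conjTranspose ((extGrad n M S)ᴴ), form_gram, nsq_extGrad_conjTranspose_mulVec]

/-! ## §2 The corner coupling and the general splitting -/

/-- **THE CORNER COUPLING** `C = diag(n²·cnt1 (b.2) b) − E·Eᴴ`: the own-direction zero-extension charges minus the exterior Gram block.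
[folklore] -/
def cornerC : Matrix {b // starReg n M S b} {b // starReg n M S b} ℂ :=
  Matrix.diagonal (fun b => (((n : ℝ) ^ 2 * cnt1 n M S b.1.2 b.1 : ℝ) : ℂ)) - extGrad n M S * (extGrad n M S)ᴴ

/-- `C` is Hermitian. [folklore] -/
theorem cornerC_isHermitian : (cornerC n M S).IsHermitian := by
  unfold cornerC
  refine Matrix.IsHermitian.sub ?_ ?_
  · exact Matrix.isHermitian_diagonal_iff.mpr fun b => by simp [isSelfAdjoint_iff]
  · exact Matrix.isHermitian_mul_conjTranspose_self _

/-- **THE FORM OF THE COUPLING**: `re⟨A, C A⟩ = n²·Σ_b cnt1 (b.2) b‖A b‖² − extFlux A`. [folklore] -/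
theorem form_cornerC (A : {b // starReg n M S b} → ℂ) :
    star A ⬝ᵥ (cornerC n M S *ᵥ A)
      = (((n : ℝ) ^ 2 * ∑ b : {b // starReg n M S b}, cnt1 n M S b.1.2 b.1 * ‖A b‖ ^ 2 - extFlux n M S A : ℝ) : ℂ) := by
  unfold cornerC
  rw [Matrix.sub_mulVec, dotProduct_sub, form_extGram,
    form_diagonal_ofReal (fun b : {b // starReg n M S b} => (n : ℝ) ^ 2 * cnt1 n M S b.1.2 b.1) A, ← Complex.ofReal_sub, mul_sum]
  congr 1
  congr 1
  exact sum_congr rfl fun b _ => by ring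

/-- **THE GENERAL ELECTRIC SPLITTING** (ANY union of blocks): `curlRᴴ·curlR + gradR·gradRᴴ = Σ_μ W_μ + C` — directional Neumann/Dirichlet pieces
plus the corner coupling. [folklore] -/
theorem electric_general :
    (curlR n M S)ᴴ * curlR n M S + gradR n M S * (gradR n M S)ᴴ = ∑ μ, Wdir n M S μ + cornerC n M S := by
  refine ext_of_form_eq fun A => ?_
  rw [form_curl_add_div, Matrix.add_mulVec, dotProduct_add, Matrix.sum_mulVec, dotProduct_sum, form_cornerC]
  simp only [form_Wdir]
  rw [← Complex.ofReal_sum, ← Complex.ofReal_add]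
  congr 1
  -- real bookkeeping: Gaffney + the charge split
  have h1 := gaffney_region n M S A
  rw [sum_nsq_fdiff_ext_eq] at h1
  have h2 : ∑ μ, (nsq (igrad M S n μ A) + (n : ℝ) ^ 2 * ∑ b : {b // starReg n M S b}, tcnt n M S μ b.1 * ‖A b‖ ^ 2)
      = ∑ μ, nsq (igrad M S n μ A) + (n : ℝ) ^ 2 * ∑ b : {b // starReg n M S b}, (cntR n M S b.1 - cnt1 n M S b.1.2 b.1) * ‖A b‖ ^ 2 := by
    rw [sum_add_distrib, ← mul_sum, sum_comm]
    congr 2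
    refine sum_congr rfl fun b _ => ?_
    rw [← sum_mul, sum_tcnt_eq]
  rw [h2]
  have h3 : ∑ b : {b // starReg n M S b}, (cntR n M S b.1 - cnt1 n M S b.1.2 b.1) * ‖A b‖ ^ 2
      = ∑ b : {b // starReg n M S b}, cntR n M S b.1 * ‖A b‖ ^ 2 - ∑ b : {b // starReg n M S b}, cnt1 n M S b.1.2 b.1 * ‖A b‖ ^ 2 := by
    rw [← sum_sub_distrib]; exact sum_congr rfl fun b _ => by ring
  rw [h3]
  linarith

/-! ## §3 Under H1 the coupling vanishes -/

/-- **UNDER H1 THE CORNER COUPLING VANISHES** (`AtMostOneNeighbour`: every product region at `n ≥ 2`): `C = 0` — the exterior flux IS the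
own-direction charge (file 1's `extFlux_eq`), so `electric_general` reduces to `electric_splitting`. [folklore] -/
theorem cornerC_eq_zero (hH : AtMostOneNeighbour n M S) : cornerC n M S = 0 := by
  refine ext_of_form_eq fun A => ?_
  rw [form_cornerC, Matrix.zero_mulVec, dotProduct_zero, extFlux_eq n M S hH, sub_self, Complex.ofReal_zero]

end Region

end Summit.QuantumFields.BalabanUV.T4Continuum.RegionElectricGeneral

end
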